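import Summits.RiemannHypothesis.RiemannHypothesis.Theorems.PfPersistenceDefectiveTransportCoarse
import Summits.RiemannHypothesis.RiemannHypothesis.Theorems.PfPersistenceFloorRateDichotomy
import HarnessLib

/-!
# PF persistence campaign (cell `pub-rhpf`, leaf G1.22 TRANSPORT-1, gen 8): the transport kernel of
record, part 8 — the SHAPE FACE of the Weil bottom

Honest framing (verbatim, applies to every line): mechanism/rigidity campaign; no RH claims.

`ε = Literature.NumberTheory.LFunctions.weilGroundEnergy` is the bottom of the Weil form on the
window `[e^{-a}, e^{a}]`.  Parts 1–7 (12c6d1e0ddb1 … 792e6b308dbc) placed every RATE reading of the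
Grönwall transport programme (Dini / ratio / coarse / uniform speed limits) on the floor-rate
ladder.  This part places the remaining SHAPE readings — eventual convexity / concavity of `ε`
against a clock — and CORRECTS the record of part 5 (efed25b74de1,
`riemannHypothesis_iff_subexpSpeed_of_convexOn`), which carried eventual convexity of `ε` in `a` as
a zero-content regularity side condition.

PROVED here (elementary real analysis on top of Solo's informed criteria and the floor-rate
dictionary; every zero-content statement is CONDITIONAL on its displayed shape hypothesis):

* §1  a function convex on `[b, ∞)` has a LINEAR FLOOR, a function concave on `[b, ∞)` with a strict
  drop has a linear CEILING of negative slope [folklore];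
* §2  `ConvexOn ℝ (Ici b) ε` (`b > 0`) ALONE implies RH (`riemannHypothesis_of_convexOn`): a linear
  floor is a sub-exponential floor (Solo's criterion; part 7b's linear-floor rung).  Hence BOTH
  sides of part 5's `riemannHypothesis_iff_subexpSpeed_of_convexOn` hold under its hypothesis and
  the RH binder of `uniformSpeedLimit_of_convexOn_of_riemannHypothesis` is discharged by its
  convexity binder: eventual convexity in `a` is an RH-STRENGTH input (like MONO-F), not a
  regularity side condition;
* §3  the graded version: convexity against the clock `t = e^{κ a}` (`κ > 0`) gives a floor of rate
  `κ`, hence the strip `|Re ρ − 1/2| ≤ κ/2` and quasi-RH at `1/2 + κ/2` — visible zero content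
  exactly for `κ < 1`, none claimed for `κ ≥ 1`;
* §4  convexity of the archimedean gauge `G(ν) = e^{ν} ε`, `ν = 4π e^{2a}`, in its own clock is
  again RH-strength (TRANSPORT.md §11's second-order MONO-F WITHOUT its slope condition);
* §5  eventual CONCAVITY against any increasing clock REFUTES RH (strict decrease of `ε`,
  `WeilWindowFlowGronwallLeakage.weilGroundEnergy_strictAntiOn`, forces a negative slope, and a
  concave function then crosses every floor); in particular `ε` is not eventually affine in `a`
  (RH-free);
* §6  the even / odd sector twins of §2 through the floor-rate dictionary
  (`PfPersistenceFloorRateDichotomy`), and the Ω-forms (an off-line zero forbids clock-convexity).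

DERIVED placement (no new mathematics): on the GAP-CLASSES row TR1-DEFECT the "third face" of RULING
A205 / NOT-KNOWN (iii) of A216 (A2) is re-placed — RH-free eventual convexity of `ε` in `a` would
BE a proof of RH (§2), so it is not a regularity lemma one may hope to prove first; under RH it
remains an open regularity question with no further zero content.  No reach number is produced here.

References: E. Bombieri, *Remarks on Weil's quadratic functional in the theory of prime numbers I*,
Rend. Mat. Acc. Lincei (9) 11 (2000) §4 (variational picture of the window bottom);
A. Connes, C. Consani, H. Moscovici, arXiv:2511.22755, Cor. 3.7–3.8 (monotonicity of the bottom and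
the limit criterion); the convexity inequalities are [folklore] (`ConvexOn.slope_mono_adjacent`).
-/

noncomputable section

set_option linter.dupNamespace false

namespace Summit.RiemannHypothesis.RiemannHypothesis.Theorems.PfPersistenceDefectiveTransport

open Set
open _root_.Literature.NumberTheory.LFunctions
open _root_.Summit.RiemannHypothesis.RiemannHypothesis.Theorems.WeilWindowFlowGronwallLeakage
  (weilGroundEnergy_strictAntiOn)
open _root_.Summit.RiemannHypothesis.RiemannHypothesis.Theorems.PfPersistenceFloorRateDichotomy
  (quasiRiemannHypothesis_of_floor riemannHypothesis_of_weilEvenGroundEnergy_subexp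
    riemannHypothesis_iff_weilOddGroundEnergy_subexp)

/-! ## §1 Real analysis: eventual shape gives a supporting / covering line -/

/-- A function convex on `[b, ∞)` lies ABOVE the secant through `(b, f b)` and `(b + 1, f (b + 1))`
beyond `b + 1`; with the slope replaced by `-max (f b - f (b+1)) 0 ≤ slope` this is a floor.
RH-free. [folklore] -/
theorem line_le_of_convexOn {f : ℝ → ℝ} {b : ℝ} (hf : ConvexOn ℝ (Ici b) f) {t : ℝ}
    (ht : b + 1 ≤ t) : f (b + 1) - (t - (b + 1)) * max (f b - f (b + 1)) 0 ≤ f t := by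
  rcases ht.eq_or_lt with h | h
  · subst h; simp
  · have key := hf.slope_mono_adjacent (x := b) (y := b + 1) (z := t)
      (show b ∈ Ici b from self_mem_Ici) (show t ∈ Ici b by simp only [mem_Ici]; linarith)
      (by linarith) h
    have e1 : b + 1 - b = 1 := by ring
    rw [e1, div_one, le_div_iff₀ (by linarith : 0 < t - (b + 1))] at key
    have e2 : (f (b + 1) - f b) * (t - (b + 1)) = -((t - (b + 1)) * (f b - f (b + 1))) := by ring
    have h2 : (t - (b + 1)) * (f b - f (b + 1)) ≤ (t - (b + 1)) * max (f b - f (b + 1)) 0 :=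
      mul_le_mul_of_nonneg_left (le_max_left _ _) (by linarith)
    linarith

/-- **Eventual convexity gives a LINEAR FLOOR** `-(A + B t) ≤ f t` for `t ≥ b + 1` (`b ≥ -1`), with
`A = -f (b + 1)`, `B = max (f b - f (b + 1)) 0 ≥ 0`.  RH-free. [folklore] -/
theorem linearFloor_of_convexOn {f : ℝ → ℝ} {b : ℝ} (hb : -1 ≤ b) (hf : ConvexOn ℝ (Ici b) f) :
    ∀ t : ℝ, b + 1 ≤ t → -(-f (b + 1) + max (f b - f (b + 1)) 0 * t) ≤ f t := by
  intro t ht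
  have h := line_le_of_convexOn hf ht
  have hD : 0 ≤ max (f b - f (b + 1)) 0 := le_max_right _ _
  nlinarith [mul_nonneg (by linarith : (0 : ℝ) ≤ b + 1) hD]

/-- A function concave on `[b, ∞)` lies BELOW the secant through `(x, f x)` and `(y, f y)`
(`b ≤ x < y`) beyond `y`.  RH-free. [folklore] -/
theorem le_line_of_concaveOn {f : ℝ → ℝ} {b x y : ℝ} (hf : ConcaveOn ℝ (Ici b) f) (hx : b ≤ x)
    (hxy : x < y) {t : ℝ} (ht : y ≤ t) : f t ≤ f y - (t - y) * ((f x - f y) / (y - x)) := by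
  rcases ht.eq_or_lt with h | h
  · subst h; simp
  · have key := hf.slope_anti_adjacent (x := x) (y := y) (z := t)
      (show x ∈ Ici b from hx) (show t ∈ Ici b by simp only [mem_Ici]; linarith) hxy h
    rw [div_le_iff₀ (by linarith : 0 < t - y)] at key
    have e : (f y - f x) / (y - x) * (t - y) = -((t - y) * ((f x - f y) / (y - x))) := by
      rw [show f y - f x = -(f x - f y) by ring, neg_div]; ring
    linarith

/-- **A linear floor is a sub-exponential floor**: `-(A + B a) ≤ f a` for `a ≥ b ≥ 0` gives, for
every `δ > 0`, `-(K e^{δ a}) ≤ f a` for `a ≥ b` with `K = max A 0 + max B 0 / δ`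
(`δ a ≤ e^{δ a}`).  RH-free. [folklore] -/
theorem subexpFloor_of_linearFloor {f : ℝ → ℝ} {b A B : ℝ} (hb : 0 ≤ b)
    (h : ∀ a : ℝ, b ≤ a → -(A + B * a) ≤ f a) :
    ∀ δ : ℝ, 0 < δ → ∃ K a₀ : ℝ, ∀ a : ℝ, a₀ ≤ a → -(K * Real.exp (δ * a)) ≤ f a := by
  intro δ hδ
  refine ⟨max A 0 + max B 0 / δ, b, fun a ha ↦ ?_⟩
  have ha0 : 0 ≤ a := hb.trans ha
  have he1 : 1 ≤ Real.exp (δ * a) := Real.one_le_exp (by positivity)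
  have he2 : δ * a ≤ Real.exp (δ * a) := by linarith [Real.add_one_le_exp (δ * a)]
  have h1 : A ≤ max A 0 * Real.exp (δ * a) :=
    (le_max_left A 0).trans (le_mul_of_one_le_right (le_max_right A 0) he1)
  have h2 : B * a ≤ max B 0 / δ * Real.exp (δ * a) := by
    have hB : B * a ≤ max B 0 * a := mul_le_mul_of_nonneg_right (le_max_left B 0) ha0
    have : max B 0 * a = max B 0 / δ * (δ * a) := by field_simp
    rw [this] at hB
    exact hB.trans (mul_le_mul_of_nonneg_left he2 (div_nonneg (le_max_right B 0) hδ.le))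
  have e : (max A 0 + max B 0 / δ) * Real.exp (δ * a)
      = max A 0 * Real.exp (δ * a) + max B 0 / δ * Real.exp (δ * a) := by ring
  linarith [h a ha]

/-! ## §2 Eventual convexity of `ε` in `a` is RH-strength (correction of part 5) -/

/-- **Eventual convexity of the Weil bottom in `a` implies RH.**  `ConvexOn ℝ (Ici b) ε` (`b > 0`)
⟹ linear floor (§1) ⟹ sub-exponential floor ⟹ RH (Solo's
`riemannHypothesis_of_weilGroundEnergy_subexp`; equivalently part 7b's
`riemannHypothesis_of_linear_floor`, 792e6b308dbc).  CONDITIONAL on the displayed shape hypothesis,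
which is NOT claimed; proof.conditional; no RH claim.  CORRECTS part 5 / RULING A205 ("third
face"): eventual convexity is not a zero-free regularity lemma. [folklore] -/
theorem riemannHypothesis_of_convexOn {b : ℝ} (hb : 0 < b)
    (hconv : ConvexOn ℝ (Ici b) weilGroundEnergy) : _root_.RiemannHypothesis :=
  riemannHypothesis_of_weilGroundEnergy_subexp
    (subexpFloor_of_linearFloor (b := b + 1) (by linarith)
      (linearFloor_of_convexOn (by linarith) hconv))

/-- **Correction to part 5, (a).**  The RH binder of
`uniformSpeedLimit_of_convexOn_of_riemannHypothesis` (efed25b74de1) is implied by its convexity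
binder: the uniform speed limit `ε x − ε (x + h) ≤ h · ε b` holds under eventual convexity alone.
CONDITIONAL (shape hypothesis); proof.conditional; no RH claim. [folklore] -/
theorem uniformSpeedLimit_of_convexOn {b : ℝ} (hb : 0 < b)
    (hconv : ConvexOn ℝ (Ici b) weilGroundEnergy) {x h : ℝ} (hx : b + 1 ≤ x) (hh : 0 < h) :
    weilGroundEnergy x - weilGroundEnergy (x + h) ≤ h * weilGroundEnergy b :=
  uniformSpeedLimit_of_convexOn_of_riemannHypothesis (riemannHypothesis_of_convexOn hb hconv) hb
    hconv hx hh

/-- **Correction to part 5, (b).**  Under the hypothesis of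
`riemannHypothesis_iff_subexpSpeed_of_convexOn` BOTH sides of that equivalence hold: the
sub-exponential Dini speed limit is a CONSEQUENCE of eventual convexity, not a residual equivalent
to RH given convexity.  CONDITIONAL (shape hypothesis); proof.conditional; no RH claim.
[folklore] -/
theorem subexpSpeed_of_convexOn {b : ℝ} (hb : 0 < b) (hconv : ConvexOn ℝ (Ici b) weilGroundEnergy) :
    ∀ δ : ℝ, 0 < δ → ∃ b' C : ℝ, 0 < b' ∧ 0 ≤ C ∧ ∀ x : ℝ, b' ≤ x → ∀ η δ' : ℝ, 0 < η → 0 < δ' →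
      ∃ h : ℝ, 0 < h ∧ h < δ' ∧
        weilGroundEnergy x - weilGroundEnergy (x + h) ≤ h * (C * Real.exp (δ * x) + η) :=
  (riemannHypothesis_iff_subexpSpeed_of_convexOn hb hconv).1
    (riemannHypothesis_of_convexOn hb hconv)

/-- Contrapositive bookkeeping: off RH the bottom is convex on NO half-line `[b, ∞)`, `b > 0`
(it changes curvature infinitely often or is eventually strictly concave somewhere on every tail).
RH-free implication; no RH claim. [folklore] -/
theorem not_convexOn_of_not_riemannHypothesis (hRH : ¬ _root_.RiemannHypothesis) {b : ℝ}
    (hb : 0 < b) : ¬ ConvexOn ℝ (Ici b) weilGroundEnergy :=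
  fun h ↦ hRH (riemannHypothesis_of_convexOn hb h)

/-! ## §3 The graded shape thermometer: convexity against the clock `t = e^{κ a}` -/

/-- **Convexity against the exponential clock `t = e^{κ a}` gives a floor of RATE `κ`.**  If
`t ↦ ε (log t / κ)` is convex on `[t₀, ∞)` (`κ > 0`, `t₀ > 0`), then `-(K e^{κ a}) ≤ ε a` for
`a ≥ log (t₀ + 1) / κ`.  RH-free (a statement about the hypothesis only). [folklore] -/
theorem floor_of_convexOn_clock {κ t₀ : ℝ} (hκ : 0 < κ) (ht₀ : 0 < t₀)
    (hconv : ConvexOn ℝ (Ici t₀) (fun t : ℝ => weilGroundEnergy (Real.log t / κ))) :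
    ∃ K a₀ : ℝ, ∀ a : ℝ, a₀ ≤ a → -(K * Real.exp (κ * a)) ≤ weilGroundEnergy a := by
  set g : ℝ → ℝ := fun t : ℝ => weilGroundEnergy (Real.log t / κ) with hg
  refine ⟨max (-g (t₀ + 1)) 0 + max (g t₀ - g (t₀ + 1)) 0, Real.log (t₀ + 1) / κ, fun a ha ↦ ?_⟩
  have hM : 0 ≤ max (g t₀ - g (t₀ + 1)) 0 := le_max_right _ _
  have ha' : Real.log (t₀ + 1) ≤ κ * a := by
    have := (div_le_iff₀ hκ).1 ha
    linarith [mul_comm a κ]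
  have ht : t₀ + 1 ≤ Real.exp (κ * a) := by
    calc t₀ + 1 = Real.exp (Real.log (t₀ + 1)) := (Real.exp_log (by linarith)).symm
      _ ≤ Real.exp (κ * a) := Real.exp_le_exp.2 ha'
  have he1 : 1 ≤ Real.exp (κ * a) := by
    have h0 : 0 ≤ Real.log (t₀ + 1) := Real.log_nonneg (by linarith)
    exact Real.one_le_exp (h0.trans ha')
  have hfloor := linearFloor_of_convexOn (f := g) (by linarith) hconv (Real.exp (κ * a)) ht
  have hga : g (Real.exp (κ * a)) = weilGroundEnergy a := by
    simp only [hg, Real.log_exp, mul_div_cancel_left₀ a hκ.ne']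
  rw [hga] at hfloor
  have h3 : -g (t₀ + 1) ≤ max (-g (t₀ + 1)) 0 * Real.exp (κ * a) :=
    (le_max_left _ _).trans (le_mul_of_one_le_right (le_max_right _ _) he1)
  have e : (max (-g (t₀ + 1)) 0 + max (g t₀ - g (t₀ + 1)) 0) * Real.exp (κ * a)
      = max (-g (t₀ + 1)) 0 * Real.exp (κ * a) + max (g t₀ - g (t₀ + 1)) 0 * Real.exp (κ * a) := by
    ring
  linarith

/-- **The shape thermometer.**  Convexity of `t ↦ ε (log t / κ)` on `[t₀, ∞)` (`κ > 0`, `t₀ > 0`)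
confines every nontrivial zero to `|Re ρ − 1/2| ≤ κ/2` (Solo's
`abs_re_sub_half_le_of_weilGroundEnergy_exp_lower`).  Visible zero content exactly for `κ < 1`;
for `κ ≥ 1` the conclusion is trivial and NOTHING is claimed.  CONDITIONAL (shape hypothesis, not
claimed); proof.conditional; no RH claim. [folklore] -/
theorem strip_of_convexOn_clock {κ t₀ : ℝ} (hκ : 0 < κ) (ht₀ : 0 < t₀)
    (hconv : ConvexOn ℝ (Ici t₀) (fun t : ℝ => weilGroundEnergy (Real.log t / κ)))
    {ρ : ℂ} (hρ : ρ ∈ ZetaZeros.riemannZetaNontrivialZeros) : |ρ.re - 1 / 2| ≤ κ / 2 := by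
  obtain ⟨K, a₀, h⟩ := floor_of_convexOn_clock hκ ht₀ hconv
  exact abs_re_sub_half_le_of_weilGroundEnergy_exp_lower hκ.le h hρ

/-- **Quasi-RH form of the shape thermometer**: clock-`κ` convexity ⟹ no zero with
`1/2 + κ/2 < Re s < 1` (floor-rate dictionary `quasiRiemannHypothesis_of_floor`).  CONDITIONAL;
proof.conditional; no RH claim. [folklore] -/
theorem quasiRiemannHypothesis_of_convexOn_clock {κ t₀ : ℝ} (hκ : 0 < κ) (ht₀ : 0 < t₀)
    (hconv : ConvexOn ℝ (Ici t₀) (fun t : ℝ => weilGroundEnergy (Real.log t / κ))) :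
    QuasiRiemannHypothesis (1 / 2 + κ / 2) := by
  obtain ⟨K, a₀, h⟩ := floor_of_convexOn_clock hκ ht₀ hconv
  exact quasiRiemannHypothesis_of_floor hκ.le h

/-- **Ω-form.**  A zero `ρ` with `|Re ρ − 1/2| > κ/2` forbids convexity of `ε` against the clock
`e^{κ a}` on every half-line.  RH-free implication; no RH claim. [folklore] -/
theorem not_convexOn_clock_of_offline_zero {ρ : ℂ} (hρ : ρ ∈ ZetaZeros.riemannZetaNontrivialZeros)
    {κ : ℝ} (hκ : 0 < κ) (hfar : κ / 2 < |ρ.re - 1 / 2|) {t₀ : ℝ} (ht₀ : 0 < t₀) :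
    ¬ ConvexOn ℝ (Ici t₀) (fun t : ℝ => weilGroundEnergy (Real.log t / κ)) :=
  fun h ↦ (not_le.2 hfar) (strip_of_convexOn_clock hκ ht₀ h hρ)

/-! ## §4 The archimedean gauge: convexity of `G(ν) = e^{ν} ε` in `ν = 4π e^{2a}` is RH-strength -/

/-- Arithmetic of §4: a linear floor for `e^{ν} x` in `ν ≥ 0` is a CONSTANT floor for `x`.
RH-free. [folklore] -/
theorem neg_le_of_linearFloor_exp {G₁ M ν x : ℝ} (hM : 0 ≤ M) (hν : 0 ≤ ν)
    (h : -(-G₁ + M * ν) ≤ Real.exp ν * x) : -(max (-G₁) 0 + M) ≤ x := by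
  have he1 : 1 ≤ Real.exp ν := Real.one_le_exp hν
  have he2 : ν ≤ Real.exp ν := by linarith [Real.add_one_le_exp ν]
  have hpos : 0 < Real.exp ν := Real.exp_pos ν
  by_contra hlt
  rw [not_le] at hlt
  have h1 : Real.exp ν * x < Real.exp ν * (-(max (-G₁) 0 + M)) := mul_lt_mul_of_pos_left hlt hpos
  have h2 : max (-G₁) 0 ≤ Real.exp ν * max (-G₁) 0 := le_mul_of_one_le_left (le_max_right _ _) he1
  have h3 : M * ν ≤ Real.exp ν * M := by nlinarith
  have h4 : -G₁ ≤ max (-G₁) 0 := le_max_left _ _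
  have e : Real.exp ν * (-(max (-G₁) 0 + M)) = -(Real.exp ν * max (-G₁) 0) - Real.exp ν * M := by
    ring
  linarith

/-- **Convexity of the archimedean gauge in its own clock implies RH.**  With `ν = 4π e^{2a}` and
`G(ν) = e^{ν} ε(a) = e^{ν} ε (log (ν / 4π) / 2)`: `G` convex on `[ν₀, ∞)` (`ν₀ > 0`) ⟹ `G ≥` a line
⟹ `ε a ≥ −(A + B ν) e^{−ν} ≥ −(A⁺ + B)` eventually ⟹ RH (rate-zero rung).  This is TRANSPORT.md
§11's second-order form of MONO-F with its slope condition `G′(ν₀) ≥ 0` REMOVED: the curvature sign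
alone is already RH-strength.  CONDITIONAL (shape hypothesis, not claimed); proof.conditional;
no RH claim. [folklore] -/
theorem riemannHypothesis_of_convexOn_archGauge {ν₀ : ℝ} (hν₀ : 0 < ν₀)
    (hconv : ConvexOn ℝ (Ici ν₀)
      (fun ν : ℝ => Real.exp ν * weilGroundEnergy (Real.log (ν / (4 * Real.pi)) / 2))) :
    _root_.RiemannHypothesis := by
  set G : ℝ → ℝ :=
    fun ν : ℝ => Real.exp ν * weilGroundEnergy (Real.log (ν / (4 * Real.pi)) / 2) with hG
  have hM : 0 ≤ max (G ν₀ - G (ν₀ + 1)) 0 := le_max_right _ _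
  have hπ : 0 < 4 * Real.pi := by positivity
  refine riemannHypothesis_of_weilGroundEnergy_subexp (subexpFloor_of_linearFloor
    (b := max (Real.log ((ν₀ + 1) / (4 * Real.pi)) / 2) 1)
    (A := max (-G (ν₀ + 1)) 0 + max (G ν₀ - G (ν₀ + 1)) 0) (B := 0)
    (zero_le_one.trans (le_max_right _ _)) fun a ha ↦ ?_)
  have ha1 : Real.log ((ν₀ + 1) / (4 * Real.pi)) / 2 ≤ a := (le_max_left _ _).trans ha
  have hν1 : ν₀ + 1 ≤ 4 * Real.pi * Real.exp (2 * a) := by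
    have h2 : (ν₀ + 1) / (4 * Real.pi) ≤ Real.exp (2 * a) := by
      calc (ν₀ + 1) / (4 * Real.pi) = Real.exp (Real.log ((ν₀ + 1) / (4 * Real.pi))) :=
            (Real.exp_log (by positivity)).symm
        _ ≤ Real.exp (2 * a) := Real.exp_le_exp.2 (by linarith)
    have := (div_le_iff₀ hπ).1 h2
    linarith [mul_comm (Real.exp (2 * a)) (4 * Real.pi)]
  have hGν : G (4 * Real.pi * Real.exp (2 * a))
      = Real.exp (4 * Real.pi * Real.exp (2 * a)) * weilGroundEnergy a := by
    have e1 : 4 * Real.pi * Real.exp (2 * a) / (4 * Real.pi) = Real.exp (2 * a) := by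
      field_simp
    simp only [hG, e1, Real.log_exp]
    ring_nf
  have hfloor := linearFloor_of_convexOn (f := G) (by linarith) hconv _ hν1
  rw [hGν] at hfloor
  have hνpos : 0 ≤ 4 * Real.pi * Real.exp (2 * a) := by positivity
  have := neg_le_of_linearFloor_exp hM hνpos hfloor
  simpa using this

/-! ## §5 Eventual concavity refutes RH; the bottom is not eventually affine (RH-free) -/

/-- **Eventual concavity against ANY increasing clock refutes RH.**  If `t ↦ ε (ψ t)` is concave on
`[t₀, ∞)` for some `ψ` strictly increasing there with `ψ t₀ > 0`, then `¬ RH`: `ε` strictly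
decreases on `(0, ∞)` (`weilGroundEnergy_strictAntiOn`), so the concave function has a secant of
negative slope and lies below it beyond `t₀ + 1` (§1), hence is eventually negative — while RH
forces `ε ≥ 0` (Solo).  RH-free implication; the shape hypothesis is NOT claimed; no RH claim.
[folklore] -/
theorem not_riemannHypothesis_of_concaveOn_clock {ψ : ℝ → ℝ} {t₀ : ℝ}
    (hψ : StrictMonoOn ψ (Ici t₀)) (hψ0 : 0 < ψ t₀)
    (hconc : ConcaveOn ℝ (Ici t₀) (fun t : ℝ => weilGroundEnergy (ψ t))) :
    ¬ _root_.RiemannHypothesis := by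
  intro hRH
  set g : ℝ → ℝ := fun t : ℝ => weilGroundEnergy (ψ t) with hg
  have hmem1 : t₀ + 1 ∈ Ici t₀ := by simp only [mem_Ici]; linarith
  have hψ1 : ψ t₀ < ψ (t₀ + 1) := hψ self_mem_Ici hmem1 (by linarith)
  have hdrop : g (t₀ + 1) < g t₀ :=
    weilGroundEnergy_strictAntiOn (mem_Ioi.2 hψ0) (mem_Ioi.2 (hψ0.trans hψ1)) hψ1
  set c : ℝ := (g t₀ - g (t₀ + 1)) / (t₀ + 1 - t₀) with hc
  have hc1 : c = g t₀ - g (t₀ + 1) := by rw [hc]; simp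
  have hcpos : 0 < c := by rw [hc1]; linarith
  set t : ℝ := t₀ + 1 + (max (g (t₀ + 1) / c) 0 + 1) with ht
  have hmax : 0 ≤ max (g (t₀ + 1) / c) 0 := le_max_right _ _
  have htge : t₀ + 1 ≤ t := by rw [ht]; linarith
  have hceil := le_line_of_concaveOn hconc (le_refl t₀) (by linarith : t₀ < t₀ + 1) htge
  rw [← hc] at hceil
  have hmemt : t ∈ Ici t₀ := by simp only [mem_Ici]; linarith
  have hψt : 0 < ψ t := hψ0.trans_le (hψ.monotoneOn self_mem_Ici hmemt (by linarith))
  have hpos : 0 ≤ g t := weilGroundEnergy_nonneg_of_riemannHypothesis hRH hψt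
  have h1 : (t - (t₀ + 1)) * c = max (g (t₀ + 1) / c) 0 * c + c := by rw [ht]; ring
  have h2 : g (t₀ + 1) ≤ max (g (t₀ + 1) / c) 0 * c :=
    calc g (t₀ + 1) = g (t₀ + 1) / c * c := (div_mul_cancel₀ _ hcpos.ne').symm
      _ ≤ max (g (t₀ + 1) / c) 0 * c := mul_le_mul_of_nonneg_right (le_max_left _ _) hcpos.le
  linarith

/-- **Eventual concavity of `ε` in `a` refutes RH** (clock `ψ = id`).  RH-free implication; shape
hypothesis not claimed; no RH claim. [folklore] -/
theorem not_riemannHypothesis_of_concaveOn {b : ℝ} (hb : 0 < b)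
    (hconc : ConcaveOn ℝ (Ici b) weilGroundEnergy) : ¬ _root_.RiemannHypothesis :=
  not_riemannHypothesis_of_concaveOn_clock (ψ := id) (strictMono_id.strictMonoOn _) hb hconc

/-- **Eventual concavity against the clock `t = e^{κ a}` refutes RH** (`κ > 0`, any `t₀ > 0`; the
concavity is used on `[max t₀ 2, ∞)`).  RH-free implication; no RH claim. [folklore] -/
theorem not_riemannHypothesis_of_concaveOn_expClock {κ t₀ : ℝ} (hκ : 0 < κ) (ht₀ : 0 < t₀)
    (hconc : ConcaveOn ℝ (Ici t₀) (fun t : ℝ => weilGroundEnergy (Real.log t / κ))) :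
    ¬ _root_.RiemannHypothesis := by
  have hsub : Ici (max t₀ 2) ⊆ Ici t₀ := Ici_subset_Ici.2 (le_max_left _ _)
  refine not_riemannHypothesis_of_concaveOn_clock (ψ := fun t : ℝ => Real.log t / κ)
    (t₀ := max t₀ 2) ?_ ?_ (hconc.subset hsub (convex_Ici _))
  · intro x hx y hy hxy
    have hx0 : 0 < x := lt_of_lt_of_le (by positivity) (le_trans (le_max_left t₀ 2) hx)
    exact div_lt_div_of_pos_right (Real.log_lt_log hx0 hxy) hκ
  · have h2 : (1 : ℝ) < max t₀ 2 := lt_of_lt_of_le (by norm_num) (le_max_right _ _)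
    exact div_pos (Real.log_pos h2) hκ

/-- **The Weil bottom is NOT eventually affine in `a`**: an affine function on `[b, ∞)` is convex
(⟹ RH, §2) and concave (⟹ ¬RH, §5).  UNCONDITIONAL, RH-free; no RH claim.  (Against the clock
`e^{κ a}` the same argument gives only: affine ⟹ ¬RH ∧ quasi-RH at `1/2 + κ/2`, §3/§5.)
[folklore] -/
theorem not_convexOn_and_concaveOn {b : ℝ} (hb : 0 < b) :
    ¬ (ConvexOn ℝ (Ici b) weilGroundEnergy ∧ ConcaveOn ℝ (Ici b) weilGroundEnergy) :=
  fun h ↦ not_riemannHypothesis_of_concaveOn hb h.2 (riemannHypothesis_of_convexOn hb h.1)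

/-! ## §6 Sector twins and the parity-free reading -/

/-- **Even-sector twin.**  Eventual convexity in `a` of the even-sector bottom `ε_ev` (the PF object
of the cell) implies RH: linear floor (§1) ⟹ sub-exponential floor ⟹ RH
(`riemannHypothesis_of_weilEvenGroundEnergy_subexp`).  CONDITIONAL (shape hypothesis, not claimed);
proof.conditional; no RH claim. [folklore] -/
theorem riemannHypothesis_of_convexOn_even {b : ℝ} (hb : 0 < b)
    (hconv : ConvexOn ℝ (Ici b) weilEvenGroundEnergy) : _root_.RiemannHypothesis :=
  riemannHypothesis_of_weilEvenGroundEnergy_subexp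
    (subexpFloor_of_linearFloor (b := b + 1) (by linarith)
      (linearFloor_of_convexOn (by linarith) hconv))

/-- **Odd-sector twin.**  Eventual convexity in `a` of the odd-sector bottom `ε_odd` implies RH
(`riemannHypothesis_iff_weilOddGroundEnergy_subexp`).  CONDITIONAL; proof.conditional; no RH claim.
[folklore] -/
theorem riemannHypothesis_of_convexOn_odd {b : ℝ} (hb : 0 < b)
    (hconv : ConvexOn ℝ (Ici b) weilOddGroundEnergy) : _root_.RiemannHypothesis :=
  riemannHypothesis_iff_weilOddGroundEnergy_subexp.2
    (subexpFloor_of_linearFloor (b := b + 1) (by linarith)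
      (linearFloor_of_convexOn (by linarith) hconv))

end Summit.RiemannHypothesis.RiemannHypothesis.Theorems.PfPersistenceDefectiveTransport

end
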